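import Mathlib
import Summits.AtomisticToContinuum.FouriersLaw.Theorems.EmbeddedDrudeMourreKineticConductivityFiniteAlgebra
import Literature.MathematicalPhysics.KineticTheory.PinnedChainBoltzmannOperator
import HarnessLib

/-!
# `EmbeddedDrudeMourre.KineticConductivityFinite` — momentum reversal and the resolved energy delta

Helper file (supports item `stmt-AtomisticToContinuum-12599`, route `EmbeddedDrudeMourre`, sub-problem
`FouriersLaw`). Infrastructure for the FINITENESS half of the item (the parity argument
`q(f_odd) ≤ q(f)`):

* symmetries of ALS's resolved kernel: `collisionWeight`, `resonanceFn` are invariant under the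
  global momentum reversal `k ↦ -k` and `2π`-periodic in the partner momentum `k₂`;
* `setLIntegral_cell_neg`: `∫⁻_{(-π,π]} G(-k) dk = ∫⁻_{(-π,π]} G(k) dk`;
* `finsum_reflect`: the resolved energy delta of `f(-·)` at `(k₁, k₃)` is that of `f` at
  `(-k₁, -k₃)` (bijection `k₂ ↦ -k₂ mod 2π` of the resonant fibres);
* `two_mul_finsum_oddPart_le`: the parallelogram bound `2 Σ w B[f_odd]² ≤ Σ w B[f]² + Σ w B[f(-·)]²`
  on every fibre;
* `exists_measurable_repr`: for measurable `f` the fibre sum `(k₁,k₃) ↦ Σ_{k₂ resonant} w B[f]²`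
  agrees on the cell with a (jointly) MEASURABLE function — via the twelve explicit candidates of
  `mem_candidates` (a uniformisation of the resonant fibres) — which is what allows splitting lower
  Lebesgue integrals of sums downstream.

References: Aoki–Lukkarinen–Spohn 2006 §4; Lukkarinen–Spohn 2008 Def. 2.3 / Prop. 2.4 (parity).
-/

noncomputable section

open Real Set MeasureTheory
open scoped ENNReal

namespace Summit.AtomisticToContinuum.FouriersLaw.Theorems.KineticConductivityFinite

open Literature.MathematicalPhysics.KineticTheory.PhononBoltzmann

/-! ### 1. Symmetries of the resolved kernel -/

/-- `Ω` is invariant under global momentum reversal (`ω` is even). [cite: LukkarinenSpohn2008, Def. 2.3 and Prop. 2.4] -/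
theorem resonanceFn_neg (ω₂ k₁ k₂ k₃ : ℝ) :
    resonanceFn ω₂ (-k₁) (-k₂) (-k₃) = resonanceFn ω₂ k₁ k₂ k₃ := by
  unfold resonanceFn
  rw [show -k₁ + -k₂ - -k₃ = -(k₁ + k₂ - k₃) by ring]
  simp only [dispersion_neg]

/-- `Ω(k₁, ·, k₃)` is `2π`-periodic. [folklore] -/
theorem resonanceFn_periodic₂ (ω₂ k₁ k₃ : ℝ) :
    Function.Periodic (fun k₂ => resonanceFn ω₂ k₁ k₂ k₃) (2 * π) := by
  intro k₂
  simp only []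
  unfold resonanceFn
  rw [show k₁ + (k₂ + 2 * π) - k₃ = k₁ + k₂ - k₃ + 2 * π by ring, dispersion_periodic ω₂ k₂,
    dispersion_periodic ω₂ (k₁ + k₂ - k₃)]

/-- `Ω(k₁, k₂ + 2mπ, k₃) = Ω(k₁, k₂, k₃)`. [folklore] -/
theorem resonanceFn_add_zsmul₂ (ω₂ k₁ k₂ k₃ : ℝ) (m : ℤ) :
    resonanceFn ω₂ k₁ (k₂ + m • (2 * π)) k₃ = resonanceFn ω₂ k₁ k₂ k₃ :=
  (resonanceFn_periodic₂ ω₂ k₁ k₃).zsmul m k₂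

/-- The vertex is invariant under global momentum reversal (four sign flips). [folklore] -/
theorem vertex_neg (a b k₁ k₂ k₃ : ℝ) : vertex a b (-k₁) (-k₂) (-k₃) = vertex a b k₁ k₂ k₃ := by
  unfold vertex
  rw [show (-k₁ + -k₂ - -k₃) / 2 = -((k₁ + k₂ - k₃) / 2) by ring, neg_div, neg_div, neg_div]
  simp only [Real.sin_neg]
  ring

/-- The vertex is `2π`-periodic in `k₂`. [folklore] -/
theorem vertex_add_two_pi₂ (a b k₁ k₂ k₃ : ℝ) :
    vertex a b k₁ (k₂ + 2 * π) k₃ = vertex a b k₁ k₂ k₃ := by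
  unfold vertex
  have h2 : Real.sin ((k₂ + 2 * π) / 2) = -Real.sin (k₂ / 2) := by
    rw [show (k₂ + 2 * π) / 2 = k₂ / 2 + π by ring, Real.sin_add_pi]
  have h4 : Real.sin ((k₁ + (k₂ + 2 * π) - k₃) / 2) = -Real.sin ((k₁ + k₂ - k₃) / 2) := by
    rw [show (k₁ + (k₂ + 2 * π) - k₃) / 2 = (k₁ + k₂ - k₃) / 2 + π by ring, Real.sin_add_pi]
  rw [h2, h4]
  ring

/-- The collision kernel is invariant under global momentum reversal.
[cite: LukkarinenSpohn2008, Def. 2.3 and Prop. 2.4] -/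
theorem collisionWeight_neg (ω₂ a b k₁ k₂ k₃ : ℝ) :
    collisionWeight ω₂ a b (-k₁) (-k₂) (-k₃) = collisionWeight ω₂ a b k₁ k₂ k₃ := by
  unfold collisionWeight resonanceJacobian
  rw [vertex_neg, show -k₁ + -k₂ - -k₃ = -(k₁ + k₂ - k₃) by ring]
  simp only [dispersion_neg, groupVelocity_neg]
  rw [show -groupVelocity ω₂ k₂ - -groupVelocity ω₂ (k₁ + k₂ - k₃) =
      -(groupVelocity ω₂ k₂ - groupVelocity ω₂ (k₁ + k₂ - k₃)) by ring, abs_neg]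

/-- The collision kernel is `2π`-periodic in `k₂`. [folklore] -/
theorem collisionWeight_periodic₂ (ω₂ a b k₁ k₃ : ℝ) :
    Function.Periodic (fun k₂ => collisionWeight ω₂ a b k₁ k₂ k₃) (2 * π) := by
  intro k₂
  simp only []
  unfold collisionWeight resonanceJacobian
  rw [vertex_add_two_pi₂, dispersion_periodic ω₂ k₂,
    show k₁ + (k₂ + 2 * π) - k₃ = k₁ + k₂ - k₃ + 2 * π by ring,
    dispersion_periodic ω₂ (k₁ + k₂ - k₃), groupVelocity_periodic ω₂ k₂,
    groupVelocity_periodic ω₂ (k₁ + k₂ - k₃)]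

/-- `w(k₁, k₂ + 2mπ, k₃) = w(k₁, k₂, k₃)`. [folklore] -/
theorem collisionWeight_add_zsmul₂ (ω₂ a b k₁ k₂ k₃ : ℝ) (m : ℤ) :
    collisionWeight ω₂ a b k₁ (k₂ + m • (2 * π)) k₃ = collisionWeight ω₂ a b k₁ k₂ k₃ :=
  (collisionWeight_periodic₂ ω₂ a b k₁ k₃).zsmul m k₂

/-! ### 2. Reflection of the cell -/

/-- **Reflection invariance of the cell for lower integrals**: `∫⁻_{(-π,π]} G(-k) = ∫⁻_{(-π,π]} G(k)`
(Lebesgue measure is reflection invariant; `(-π,π]` and `[-π,π)` differ by a null set). No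
measurability of `G` is needed. [folklore] -/
theorem setLIntegral_cell_neg (G : ℝ → ℝ≥0∞) :
    ∫⁻ k in Ioc (-π) π, G (-k) = ∫⁻ k in Ioc (-π) π, G k := by
  set e := MeasurableEquiv.neg ℝ with he
  have hmap : Measure.map e (volume.restrict (Ioc (-π) π)) = volume.restrict (Ioc (-π) π) := by
    have h1 := e.measurableEmbedding.restrict_map volume (Ico (-π) π)
    have h2 : Measure.map e (volume : Measure ℝ) = volume := Measure.map_neg_eq_self _
    have h3 : e ⁻¹' Ico (-π) π = Ioc (-π) π := by
      ext k
      change (-π ≤ -k ∧ -k < π) ↔ (-π < k ∧ k ≤ π)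
      constructor <;> intro h <;> constructor <;> linarith [h.1, h.2]
    rw [h2, h3] at h1
    rw [← h1]
    exact Measure.restrict_congr_set (Ico_ae_eq_Icc.trans Ioc_ae_eq_Icc.symm)
  calc ∫⁻ k in Ioc (-π) π, G (-k) = ∫⁻ k, G k ∂(Measure.map e (volume.restrict (Ioc (-π) π))) :=
        (lintegral_map_equiv G e).symm
    _ = ∫⁻ k in Ioc (-π) π, G k := by rw [hmap]

/-! ### 3. The resolved energy delta of `f(-·)` -/

/-- `toIocMod` into the cell is congruent to its argument modulo `2π`. [folklore] -/
theorem exists_toIocMod_eq (x : ℝ) :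
    ∃ m : ℤ, toIocMod Real.two_pi_pos (-π) x = x + m • (2 * π) :=
  ⟨-toIocDiv Real.two_pi_pos (-π) x, by rw [toIocMod, neg_zsmul, sub_eq_add_neg]⟩

/-- The reflection `k₂ ↦ (-k₂ mod 2π)` maps the resonant fibre over `(k₁, k₃)` into the fibre over
`(-k₁, -k₃)`. [cite: LukkarinenSpohn2008, Def. 2.3 and Prop. 2.4] -/
theorem mapsTo_reflect_resonantSet (ω₂ k₁ k₃ : ℝ) :
    MapsTo (fun k₂ => toIocMod Real.two_pi_pos (-π) (-k₂)) (resonantSet ω₂ k₁ k₃)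
      (resonantSet ω₂ (-k₁) (-k₃)) := by
  intro k₂ hk₂
  refine ⟨?_, ?_⟩
  · -- the representative lands in the cell (cf. `FGRGap.FoldJetRigidity.Generic.toIocMod_mem_cell`)
    have h := toIocMod_mem_Ioc Real.two_pi_pos (-π) (-k₂)
    rwa [show -π + 2 * π = π by ring] at h
  obtain ⟨m, hm⟩ := exists_toIocMod_eq (-k₂)
  simp only []
  rw [hm, resonanceFn_add_zsmul₂, resonanceFn_neg]
  exact hk₂.2

/-- The reflection is a bijection between the fibres over `(k₁, k₃)` and `(-k₁, -k₃)`. [folklore] -/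
theorem bijOn_reflect_resonantSet (ω₂ k₁ k₃ : ℝ) :
    BijOn (fun k₂ => toIocMod Real.two_pi_pos (-π) (-k₂)) (resonantSet ω₂ k₁ k₃)
      (resonantSet ω₂ (-k₁) (-k₃)) := by
  have hinv : ∀ k₂ ∈ Ioc (-π) π,
      toIocMod Real.two_pi_pos (-π) (-toIocMod Real.two_pi_pos (-π) (-k₂)) = k₂ := by
    intro k₂ hk₂
    obtain ⟨m, hm⟩ := exists_toIocMod_eq (-k₂)
    rw [hm, neg_add, neg_neg, ← neg_zsmul, toIocMod_add_zsmul,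
      (toIocMod_eq_self _).2 (by rwa [show -π + 2 * π = π by ring])]
  refine ⟨mapsTo_reflect_resonantSet ω₂ k₁ k₃, ?_, ?_⟩
  · intro x hx y hy hxy
    have := congrArg (fun k => toIocMod Real.two_pi_pos (-π) (-k)) hxy
    simp only [hinv x hx.1, hinv y hy.1] at this
    exact this
  · intro y hy
    refine ⟨toIocMod Real.two_pi_pos (-π) (-y), ?_, hinv y hy.1⟩
    have h := mapsTo_reflect_resonantSet ω₂ (-k₁) (-k₃) hy
    simp only [neg_neg] at h
    exact h

/-- **The resolved energy delta of the reflected function.** For `2π`-periodic `f`, the fibre sum of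
`f(-·)` at `(k₁, k₃)` equals the fibre sum of `f` at `(-k₁, -k₃)`.
[cite: LukkarinenSpohn2008, Def. 2.3 and Prop. 2.4] -/
theorem finsum_reflect {ω₂ : ℝ} (a b : ℝ) {f : ℝ → ℝ} (hper : Function.Periodic f (2 * π))
    (k₁ k₃ : ℝ) :
    (∑ᶠ k₂ ∈ resonantSet ω₂ k₁ k₃, collisionWeight ω₂ a b k₁ k₂ k₃ *
        (f (-k₁) + f (-k₂) - f (-k₃) - f (-(k₁ + k₂ - k₃))) ^ 2) =
      ∑ᶠ k₂ ∈ resonantSet ω₂ (-k₁) (-k₃), collisionWeight ω₂ a b (-k₁) k₂ (-k₃) *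
        (f (-k₁) + f k₂ - f (-k₃) - f (-k₁ + k₂ - -k₃)) ^ 2 := by
  apply finsum_mem_eq_of_bijOn _ (bijOn_reflect_resonantSet ω₂ k₁ k₃)
  intro k₂ _
  obtain ⟨m, hm⟩ := exists_toIocMod_eq (-k₂)
  rw [hm, collisionWeight_add_zsmul₂, collisionWeight_neg, (hper.zsmul m) (-k₂),
    show -k₁ + (-k₂ + m • (2 * π)) - -k₃ = -(k₁ + k₂ - k₃) + m • (2 * π) by ring,
    (hper.zsmul m) (-(k₁ + k₂ - k₃))]

/-! ### 4. The parallelogram bound on a fibre -/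

/-- Fibre sums of non-negative terms are non-negative. [folklore] -/
theorem finsum_mem_nonneg' {s : Set ℝ} {F : ℝ → ℝ} (hF : ∀ k, 0 ≤ F k) : 0 ≤ ∑ᶠ k ∈ s, F k :=
  finsum_nonneg fun k => finsum_nonneg fun _ => hF k

/-- **Parallelogram bound.** On every fibre over the cell,
`2 Σ w·B[f_odd]² ≤ Σ w·B[f]² + Σ w·B[f(-·)]²`, `f_odd = (f - f(-·))/2`
(pointwise `2((B - B')/2)² ≤ B² + B'²`; finite fibres off the diagonal, vanishing brackets on it).
[folklore] -/
theorem two_mul_finsum_oddPart_le {ω₂ : ℝ} (hω : 0 < ω₂) (a b : ℝ) (f : ℝ → ℝ) {k₁ k₃ : ℝ}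
    (hk₁ : k₁ ∈ Ioc (-π) π) (hk₃ : k₃ ∈ Ioc (-π) π) :
    2 * (∑ᶠ k₂ ∈ resonantSet ω₂ k₁ k₃, collisionWeight ω₂ a b k₁ k₂ k₃ *
        ((f k₁ - f (-k₁)) / 2 + (f k₂ - f (-k₂)) / 2 - (f k₃ - f (-k₃)) / 2 -
          (f (k₁ + k₂ - k₃) - f (-(k₁ + k₂ - k₃))) / 2) ^ 2) ≤
      (∑ᶠ k₂ ∈ resonantSet ω₂ k₁ k₃, collisionWeight ω₂ a b k₁ k₂ k₃ *
          (f k₁ + f k₂ - f k₃ - f (k₁ + k₂ - k₃)) ^ 2) +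
        ∑ᶠ k₂ ∈ resonantSet ω₂ k₁ k₃, collisionWeight ω₂ a b k₁ k₂ k₃ *
          (f (-k₁) + f (-k₂) - f (-k₃) - f (-(k₁ + k₂ - k₃))) ^ 2 := by
  by_cases hne : k₁ = k₃
  · subst hne
    rw [finsum_mem_of_eqOn_zero, finsum_mem_of_eqOn_zero, finsum_mem_of_eqOn_zero]
    · simp
    · intro k₂ _; simp only [add_sub_cancel_left, Pi.zero_apply]; ring
    · intro k₂ _; simp only [add_sub_cancel_left, Pi.zero_apply]; ring
    · intro k₂ _; simp only [add_sub_cancel_left, Pi.zero_apply]; ring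
  have hfin := resonantSet_finite hω hk₁ hk₃ hne
  rw [finsum_mem_eq_finite_toFinset_sum _ hfin, finsum_mem_eq_finite_toFinset_sum _ hfin,
    finsum_mem_eq_finite_toFinset_sum _ hfin, Finset.mul_sum, ← Finset.sum_add_distrib]
  apply Finset.sum_le_sum
  intro k₂ _
  have hw := collisionWeight_nonneg ω₂ a b k₁ k₂ k₃
  set w := collisionWeight ω₂ a b k₁ k₂ k₃
  set B := f k₁ + f k₂ - f k₃ - f (k₁ + k₂ - k₃)
  set B' := f (-k₁) + f (-k₂) - f (-k₃) - f (-(k₁ + k₂ - k₃))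
  have hBo : (f k₁ - f (-k₁)) / 2 + (f k₂ - f (-k₂)) / 2 - (f k₃ - f (-k₃)) / 2 -
      (f (k₁ + k₂ - k₃) - f (-(k₁ + k₂ - k₃))) / 2 = (B - B') / 2 := by
    simp only [B, B']; ring
  rw [hBo]
  have : w * B ^ 2 + w * B' ^ 2 - 2 * (w * ((B - B') / 2) ^ 2) = w * (B + B') ^ 2 / 2 := by ring
  nlinarith [mul_nonneg hw (sq_nonneg (B + B'))]

end Summit.AtomisticToContinuum.FouriersLaw.Theorems.KineticConductivityFinite

end
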